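import Literature.NumberTheory.EllipticCurves.EisensteinDedekindMeasureTwo
import HarnessLib

/-!
# The transform of Stevens' smoothing: `L(Sm_r^r μ) = (1 + r² − r(1+T)^{ℓ(r)} − r(1+T)^{−ℓ(r)})·L(μ)`

Topic `Literature/NumberTheory/EllipticCurves`; namespace `Literature.NumberTheory.EllipticCurves`.
Theorem-only sequel to `EisensteinDedekindMeasureTwo` (§2 there: the operator
`stevensSmoothing r μ = μ − r[r]_*μ − r[r]^*μ + r²μ`, Stevens' `Sm_r^r = (1 − rσ(r))(1 − rσ(r)⁻¹)`).

For a BOUNDED DISTRIBUTION `μ` on `ℤ_p` and `r` prime to `p` with Teichmüller–exponent datum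
`r ≡ η_r γ^{f}` (`exists_teichmuller_exponent_natCast`), the Mazur–Tate–Teitelbaum transform of the
smoothed measure is the transform of `μ` times the **smoothing factor**
`1 + r² − r(1+T)^{f} − r(1+T)^{−f}` (`distributionTransform_stevensSmoothing_of_datum`,
existence form `distributionTransform_stevensSmoothing`) — Lang Ch. 4 §2 Meas 1 (`[c]_*` multiplies the
power series by `(1+X)^{ℓ(c)}`) applied to Stevens' two factors [Stevens1982, §5.2 (PDF pp. 68–69) and
§5.4 (PDF p. 73)].  For the generator `r = γ = 1 + p^{e₀}` itself the datum is `(η, f) = (1, 1)` at every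
level (`toZModPow_one_mul_cyclotomicGenerator_pow`), so
`L(Sm_γ^γ μ) = (1 + γ² − γ(1+T) − γ(1+T)⁻¹)·L(μ)` (`distributionTransform_stevensSmoothing_cyclotomicGenerator`);
at `p = 2` (`γ = 5`): **`L(Sm_5^5 μ) = (26 − 5(1+T) − 5(1+T)⁻¹)·L(μ)`**
(`distributionTransform_stevensSmoothing_five`), and `(1+T)·(26 − 5(1+T) − 5(1+T)⁻¹) = 16 + 16T − 5T²`
(`one_add_X_mul_smoothingFactorTwo`) — so modulo `2` the smoothing factor is `T²/(1+T)`: the `T²` of the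
BSD cell's mod-2 Eisenstein identity (★) is the reduction of Stevens' smoothing factor, one `T` per
Kubota–Leopoldt pole [Stevens1982, §5.4 (PDF p. 74)].  Also the Riemann-sum-level identity
`RS(Sm_r^r μ) = RS(μ) − r·RS([r]_*μ) − r·RS([r]^*μ) + r²·RS(μ)` (`distributionRiemannSum_stevensSmoothing`,
no hypothesis on `μ`).  Everything is proved; no named facts.

Requested for line `star` of crux `stmt-BirchSwinnertonDyer-20341` (curve side of the finite-level glue:
`μ = μ_{f,α}` the modular-symbol measure, a bounded distribution by `msdMeasure_distribution_of_isNewformOf`).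

## References

* G. Stevens, *Arithmetic on Modular Curves*, Progress in Math. 20, Birkhäuser 1982 — §5.2 (PDF pp. 68–69:
  `σ(r)`, `Sm_r = 1 − rσ(r)`), §5.4 (PDF p. 73: `Sm_{r₁}^{r₂}`, Prop. 5.4.1; PDF p. 74: the factorisation of
  `L_p(E, χ, s)`). Held text `book:stevensnd-arithmetic-modular-curves`. [Stevens1982]
* S. Lang, *Cyclotomic Fields I and II*, GTM 121, Springer 1990 — Ch. 4 §1 Example 1 and §2 Meas 1
  (PDF pp. 79–81). [LangCyclotomic1990]
* B. Mazur, J. Tate, J. Teitelbaum, *On `p`-adic analogues of the conjectures of Birch and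
  Swinnerton-Dyer*, Invent. Math. 84 (1986), §I.13. [MazurTateTeitelbaum1986Invent]
-/

noncomputable section

open scoped Classical

open Filter Topology

namespace Literature.NumberTheory.EllipticCurves

variable {p : ℕ} [Fact p.Prime]

/-! ## The smoothing at the level of Riemann sums -/

section RiemannSum

variable (μ : (n : ℕ) → ZMod (p ^ n) → ℚ_[p])

/-- `Sm_r^r μ` as a sum of four scalar multiples (unfolding, convenient for the linearity lemmas).
[cite: Stevens1982, §5.4 (PDF p. 73) (unfolding)] -/
theorem stevensSmoothing_eq_add (r : ℕ) :
    stevensSmoothing r μ =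
      μ + ((-(r : ℚ_[p])) • dilate r μ + ((-(r : ℚ_[p])) • codilate r μ + ((r : ℚ_[p]) ^ 2) • μ)) := by
  funext n a
  simp only [stevensSmoothing, Pi.add_apply, Pi.sub_apply, Pi.smul_apply, smul_eq_mul]
  ring

/-- **`RS(Sm_r^r μ)(k, n) = RS(μ) − r·RS([r]_*μ) − r·RS([r]^*μ) + r²·RS(μ)`** (finite sums; no hypothesis
on `μ`). [cite: Stevens1982, §5.4 (PDF p. 73)] [cite: MazurTateTeitelbaum1986Invent, §I.13] -/
theorem distributionRiemannSum_stevensSmoothing (r k n : ℕ) :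
    distributionRiemannSum (stevensSmoothing r μ) k n =
      distributionRiemannSum μ k n - (r : ℚ_[p]) * distributionRiemannSum (dilate r μ) k n -
        (r : ℚ_[p]) * distributionRiemannSum (codilate r μ) k n +
        (r : ℚ_[p]) ^ 2 * distributionRiemannSum μ k n := by
  rw [stevensSmoothing_eq_add, distributionRiemannSum_add, distributionRiemannSum_add,
    distributionRiemannSum_add, distributionRiemannSum_smul, distributionRiemannSum_smul,
    distributionRiemannSum_smul]
  ring

end RiemannSum

/-! ## The Teichmüller–exponent datum of the generator `γ` -/

/-- **`γ = 1·γ¹` at every level**: the Teichmüller–exponent datum (`exists_teichmuller_exponent_natCast`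
shape) of the generator `γ = 1 + p^{e₀}` is `(η, f) = (1, 1)` — at level `0` both sides are `1`
(`γ ≡ 1 (mod p^{e₀})`), at level `n ≥ 1` the exponent `(1 : ℤ/pⁿ).val` is `1`.
[cite: MazurTateTeitelbaum1986Invent, §I.13 (x = η γ^{ℓ(x)})] -/
theorem toZModPow_one_mul_cyclotomicGenerator_pow (n : ℕ) :
    PadicInt.toZModPow (n + cyclotomicExponent p)
          (((1 : rootsOfUnity (torsionOrder p) ℤ_[p]) : ℤ_[p]ˣ) : ℤ_[p]) *
        (cyclotomicGenerator p : ZMod (p ^ (n + cyclotomicExponent p))) ^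
          (PadicInt.toZModPow n (1 : ℤ_[p])).val =
      ((cyclotomicGenerator p : ℕ) : ZMod (p ^ (n + cyclotomicExponent p))) := by
  rw [OneMemClass.coe_one, Units.val_one, map_one, one_mul, map_one, ZMod.val_one_eq_one_mod]
  rcases Nat.eq_zero_or_pos n with rfl | hn
  · -- level `0`: the exponent lives in `ℤ/1`, and `γ ≡ 1 (mod p^{e₀})`
    haveI : NeZero (p ^ (0 + cyclotomicExponent p)) := ⟨pow_ne_zero _ (Fact.out : p.Prime).ne_zero⟩
    have hdvd : p ^ (0 + cyclotomicExponent p) ∣ p ^ cyclotomicExponent p := by rw [zero_add]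
    rw [pow_zero, Nat.mod_self, pow_zero, cyclotomicGenerator, Nat.cast_add, Nat.cast_one,
      (ZMod.natCast_eq_zero_iff _ _).mpr hdvd, add_zero]
  · have h1 : 1 % p ^ n = 1 :=
      Nat.mod_eq_of_lt (Nat.one_lt_pow hn.ne' (Fact.out : p.Prime).one_lt)
    rw [h1, pow_one]

omit [Fact p.Prime] in
/-- `γ` is prime to `p` (`γ = 1 + p^{e₀}`, `e₀ ≥ 1`). [cite: MazurTateTeitelbaum1986Invent, §I.13 (γ = 1 + p^{e₀} ∈ ℤ_p^×)] -/
theorem coprime_cyclotomicGenerator : p.Coprime (cyclotomicGenerator p) := by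
  have he : cyclotomicExponent p = (cyclotomicExponent p - 1) + 1 := by
    unfold cyclotomicExponent; split_ifs <;> norm_num
  rw [cyclotomicGenerator, he, pow_succ]
  exact (Nat.coprime_add_mul_right_right p 1 _).mpr (Nat.coprime_one_right p)

/-! ## The transform of the smoothed measure -/

section Transform

variable {μ : (n : ℕ) → ZMod (p ^ n) → ℚ_[p]}

/-- **`L(Sm_r^r μ) = (1 + r² − r(1+T)^{f} − r(1+T)^{−f})·L(μ)`** for a bounded distribution `μ` and `r`
prime to `p` with Teichmüller–exponent datum `r ≡ η_r γ^{f}` at all levels (Lang: `[r]_*` multiplies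
the power series by `(1+X)^{ℓ(r)}`, `[r]^*` by `(1+X)^{−ℓ(r)}`; the Teichmüller part is invisible).
[cite: Stevens1982, §5.4 (PDF pp. 73–74)] [cite: LangCyclotomic1990, Ch. 4 §2 Meas 1 (PDF p. 81)] -/
theorem distributionTransform_stevensSmoothing_of_datum {r : ℕ}
    {ηr : rootsOfUnity (torsionOrder p) ℤ_[p]} {f : ℤ_[p]}
    (hcf : ∀ n : ℕ, PadicInt.toZModPow (n + cyclotomicExponent p) ((ηr : ℤ_[p]ˣ) : ℤ_[p]) *
        (cyclotomicGenerator p : ZMod (p ^ (n + cyclotomicExponent p))) ^ (PadicInt.toZModPow n f).val =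
        (r : ZMod (p ^ (n + cyclotomicExponent p))))
    (hr : p.Coprime r)
    (hμ : ∀ (n : ℕ) (a : ZMod (p ^ n)),
      ∑ b ∈ Finset.univ.filter (fun b : ZMod (p ^ (n + 1)) ↦
        ZMod.castHom (pow_dvd_pow p n.le_succ) (ZMod (p ^ n)) b = a), μ (n + 1) b = μ n a)
    {C : ℝ} (hC : ∀ (n : ℕ) (a : ZMod (p ^ n)), ‖μ n a‖ ≤ C) :
    distributionTransform (stevensSmoothing r μ) =
      (PowerSeries.C (1 + (r : ℚ_[p]) ^ 2) - PowerSeries.C (r : ℚ_[p]) * PowerSeries.binomialSeries ℚ_[p] f -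
          PowerSeries.C (r : ℚ_[p]) * PowerSeries.binomialSeries ℚ_[p] (-f)) *
        distributionTransform μ := by
  have hdil : distributionTransform (dilate r μ) = PowerSeries.binomialSeries ℚ_[p] f * distributionTransform μ :=
    distributionTransform_dilate hcf hμ hC
  have hcod : distributionTransform (codilate r μ) =
      PowerSeries.binomialSeries ℚ_[p] (-f) * distributionTransform μ :=
    distributionTransform_codilate hcf hμ hC
  -- coefficientwise: the Riemann sums of `Sm_r^r μ` are the corresponding combination of Riemann sums
  ext k
  rw [coeff_distributionTransform]
  refine Tendsto.limUnder_eq ?_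
  have h1 := tendsto_distributionRiemannSum hμ hC k
  have h2 := tendsto_distributionRiemannSum (dilate_distribution hr hμ) (norm_dilate_le r hC) k
  have h3 := tendsto_distributionRiemannSum (codilate_distribution hr hμ) (norm_codilate_le r hC) k
  rw [hdil] at h2
  rw [hcod] at h3
  have h := ((h1.sub (h2.const_mul (r : ℚ_[p]))).sub (h3.const_mul (r : ℚ_[p]))).add
    (h1.const_mul ((r : ℚ_[p]) ^ 2))
  have hfun : distributionRiemannSum (stevensSmoothing r μ) k = fun n ↦
      distributionRiemannSum μ k n - (r : ℚ_[p]) * distributionRiemannSum (dilate r μ) k n -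
        (r : ℚ_[p]) * distributionRiemannSum (codilate r μ) k n +
        (r : ℚ_[p]) ^ 2 * distributionRiemannSum μ k n :=
    funext fun n ↦ distributionRiemannSum_stevensSmoothing μ r k n
  rw [hfun]
  refine h.congr' (Eventually.of_forall fun n ↦ rfl) |>.trans ?_
  refine le_of_eq ?_
  congr 1
  simp only [sub_mul, add_mul, map_sub, map_add, PowerSeries.coeff_C_mul, mul_assoc, one_mul]
  ring

/-- **Existence form**: for `r` prime to `p` there is `f ∈ ℤ_p` (`⟨r⟩ = γ^f`) with
`L(Sm_r^r μ) = (1 + r² − r(1+T)^{f} − r(1+T)^{−f})·L(μ)` for every bounded distribution `μ`.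
[cite: Stevens1982, §5.4 (PDF pp. 73–74)] [cite: LangCyclotomic1990, Ch. 4 §2 Meas 1 (PDF p. 81)] -/
theorem distributionTransform_stevensSmoothing {r : ℕ} (hr : ¬ p ∣ r) :
    ∃ f : ℤ_[p], ∀ (μ : (n : ℕ) → ZMod (p ^ n) → ℚ_[p]),
      (∀ (n : ℕ) (a : ZMod (p ^ n)),
        ∑ b ∈ Finset.univ.filter (fun b : ZMod (p ^ (n + 1)) ↦
          ZMod.castHom (pow_dvd_pow p n.le_succ) (ZMod (p ^ n)) b = a), μ (n + 1) b = μ n a) →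
      (∃ C : ℝ, ∀ (n : ℕ) (a : ZMod (p ^ n)), ‖μ n a‖ ≤ C) →
        distributionTransform (stevensSmoothing r μ) =
          (PowerSeries.C (1 + (r : ℚ_[p]) ^ 2) - PowerSeries.C (r : ℚ_[p]) * PowerSeries.binomialSeries ℚ_[p] f -
              PowerSeries.C (r : ℚ_[p]) * PowerSeries.binomialSeries ℚ_[p] (-f)) *
            distributionTransform μ := by
  obtain ⟨ηr, f, hcf⟩ := exists_teichmuller_exponent_natCast (p := p) hr
  have hr' : p.Coprime r := (Nat.Prime.coprime_iff_not_dvd (Fact.out : p.Prime)).mpr hr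
  exact ⟨f, fun μ hμ ⟨C, hC⟩ ↦ distributionTransform_stevensSmoothing_of_datum hcf hr' hμ hC⟩

/-- **For the generator itself: `L(Sm_γ^γ μ) = (1 + γ² − γ(1+T) − γ(1+T)⁻¹)·L(μ)`** (`ℓ(γ) = 1`).
[cite: Stevens1982, §5.4 (PDF pp. 73–74)] [cite: LangCyclotomic1990, Ch. 4 §2 Meas 1 (PDF p. 81)] -/
theorem distributionTransform_stevensSmoothing_cyclotomicGenerator
    (hμ : ∀ (n : ℕ) (a : ZMod (p ^ n)),
      ∑ b ∈ Finset.univ.filter (fun b : ZMod (p ^ (n + 1)) ↦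
        ZMod.castHom (pow_dvd_pow p n.le_succ) (ZMod (p ^ n)) b = a), μ (n + 1) b = μ n a)
    {C : ℝ} (hC : ∀ (n : ℕ) (a : ZMod (p ^ n)), ‖μ n a‖ ≤ C) :
    distributionTransform (stevensSmoothing (cyclotomicGenerator p) μ) =
      (PowerSeries.C (1 + ((cyclotomicGenerator p : ℕ) : ℚ_[p]) ^ 2) -
          PowerSeries.C ((cyclotomicGenerator p : ℕ) : ℚ_[p]) * PowerSeries.binomialSeries ℚ_[p] (1 : ℤ_[p]) -
          PowerSeries.C ((cyclotomicGenerator p : ℕ) : ℚ_[p]) * PowerSeries.binomialSeries ℚ_[p] (-1 : ℤ_[p])) *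
        distributionTransform μ :=
  distributionTransform_stevensSmoothing_of_datum (toZModPow_one_mul_cyclotomicGenerator_pow (p := p))
    coprime_cyclotomicGenerator hμ hC

end Transform

/-! ## At `p = 2`: `L(Sm_5^5 μ) = (26 − 5(1+T) − 5(1+T)⁻¹)·L(μ)` and `(1+T)·(that factor) = 16 + 16T − 5T²` -/

section Two

/-- `γ = 5` at `p = 2` (private copy of `cyclotomicGenerator_two` of
`PAdicLFunctionIntegralityAtTwoProofs`, not imported here). [cite: MazurTateTeitelbaum1986Invent, §I.13 (p = 2: γ = 5)] -/
private theorem cyclotomicGenerator_two' : cyclotomicGenerator 2 = 5 := by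
  unfold cyclotomicGenerator cyclotomicExponent; norm_num

/-- **Stevens' smoothing factor at `2`**: `26 − 5(1+T) − 5(1+T)⁻¹ ∈ ℚ₂⟦T⟧`.
[cite: Stevens1982, §5.4 (PDF p. 74)] -/
theorem distributionTransform_stevensSmoothing_five {μ : (n : ℕ) → ZMod (2 ^ n) → ℚ_[2]}
    (hμ : ∀ (n : ℕ) (a : ZMod (2 ^ n)),
      ∑ b ∈ Finset.univ.filter (fun b : ZMod (2 ^ (n + 1)) ↦
        ZMod.castHom (pow_dvd_pow 2 n.le_succ) (ZMod (2 ^ n)) b = a), μ (n + 1) b = μ n a)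
    {C : ℝ} (hC : ∀ (n : ℕ) (a : ZMod (2 ^ n)), ‖μ n a‖ ≤ C) :
    distributionTransform (stevensSmoothing 5 μ) =
      (PowerSeries.C (26 : ℚ_[2]) - PowerSeries.C (5 : ℚ_[2]) * PowerSeries.binomialSeries ℚ_[2] (1 : ℤ_[2]) -
          PowerSeries.C (5 : ℚ_[2]) * PowerSeries.binomialSeries ℚ_[2] (-1 : ℤ_[2])) *
        distributionTransform μ := by
  have h := distributionTransform_stevensSmoothing_cyclotomicGenerator (p := 2) hμ hC
  rw [cyclotomicGenerator_two'] at h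
  rw [h]
  norm_num

/-- `(1+T)^{1} = 1 + T` for the binomial series with `ℤ_p`-exponents (Lang's `(1+X)^s = ∑ (s choose n) Xⁿ`
at `s = 1`). [cite: LangCyclotomic1990, Ch. 4 §1 Example 1 (PDF p. 79, (1+X)^s)] -/
theorem binomialSeries_one_eq : PowerSeries.binomialSeries ℚ_[p] (1 : ℤ_[p]) = 1 + PowerSeries.X := by
  have h := PowerSeries.binomialSeries_nat (R := ℤ_[p]) (A := ℚ_[p]) 1
  rw [Nat.cast_one, pow_one] at h
  exact h

/-- `(1+T)·(1+T)^{−1} = 1` (`(1+X)^{s}(1+X)^{t} = (1+X)^{s+t}`). [cite: LangCyclotomic1990, Ch. 4 §1 Example 1 (PDF p. 79, (1+X)^s)] -/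
theorem one_add_X_mul_binomialSeries_neg_one :
    (1 + PowerSeries.X) * PowerSeries.binomialSeries ℚ_[p] (-1 : ℤ_[p]) = 1 := by
  rw [← binomialSeries_one_eq, ← PowerSeries.binomialSeries_add, add_neg_cancel,
    PowerSeries.binomialSeries_zero]

/-- **`(1+T)·(26 − 5(1+T) − 5(1+T)⁻¹) = 16 + 16T − 5T²`** — the smoothing factor at `2` cleared of
its denominator; modulo `2` it is `T²`, so `Sm_5^5 ≡ T²·(1+T)⁻¹`: the `T²` of the mod-2 Eisenstein
identity. [cite: Stevens1982, §5.4 (PDF p. 74)] -/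
theorem one_add_X_mul_smoothingFactorTwo :
    (1 + PowerSeries.X) *
        (PowerSeries.C (26 : ℚ_[2]) - PowerSeries.C (5 : ℚ_[2]) * PowerSeries.binomialSeries ℚ_[2] (1 : ℤ_[2]) -
          PowerSeries.C (5 : ℚ_[2]) * PowerSeries.binomialSeries ℚ_[2] (-1 : ℤ_[2])) =
      PowerSeries.C (16 : ℚ_[2]) + PowerSeries.C (16 : ℚ_[2]) * PowerSeries.X -
        PowerSeries.C (5 : ℚ_[2]) * PowerSeries.X ^ 2 := by
  have h1 := one_add_X_mul_binomialSeries_neg_one (p := 2)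
  rw [binomialSeries_one_eq (p := 2)]
  simp only [map_ofNat]
  linear_combination (-(5 : PowerSeries ℚ_[2])) * h1

end Two

end Literature.NumberTheory.EllipticCurves

end
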